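import Summits.Ventures.Crystal3D.Theorems.StickyWulffConstantNoReconstructionGainExactCriminalSmall
import Summits.Ventures.Crystal3D.Theorems.StickyWulffConstantNoReconstructionGainExactCertificate
import Literature.Geometry.DiscreteGeometry.OneSidedKissingNumberThree
import HarnessLib

/-!
# Every criminal has a CUPPED ball; cups are 7–9-pockets with shallow supports
# (line `replication-exactness`, structure of minimal counterexamples to EXACT₀)

HONEST FRAMING. Part of the venture `Summits/Ventures/Crystal3D` (cell `crystal3d-full`), supports the
crux `NoReconstructionGain` (stmt-Ventures-19144, route `route-Ventures-StickyWulffConstant`), line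
`replication-exactness` (lead wulff-p1 g18).  The orientation certificate (`…ExactCertificate`: EXACT₀ ⟺
every film's contact graph has an orientation with `indeg + plug ≤ 6`) read per film and fed with the
one-sided kissing theorems of the tree (`Literature/…/OneSidedKissingNumberThree`: `B(3) = 9`,
Musin's `a + 2b ≤ 12`):

* `exists_seven_le_plug_add_indeg_of_gain` — for EVERY orientation `o` of the contact graph of a
  GAINING film (`D(Q) < X(H,Q)`), some ball has `indeg_o + plug ≥ 7`; `…_of_criminal` — the same for a
  criminal.  With the `ν`-height orientation (lower → upper, ties broken by a fixed well-order of space;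
  `heightIndeg`) this is a **CUPPED ball**: at least seven among its plugs and its `ν`-lower film partners
  (`exists_cup_of_criminal`).
* `card_halfspace_partners_le_nine` — a film ball has at most NINE partners (plugs or film balls) in
  any closed half-space through its centre (`card_le_nine_of_unit_normal`, `B(3) = 9`);
  `two_mul_card_halfspace_partners_le` — Musin's `a + 2b ≤ 12` in the form `2k ≤ 12 + #shallow`: of `k`
  such partners at least `2k − 12` are SHALLOW (`⟪q − x, e⟫ ≤ 1/2`, within `30°` of the equator).
* `exists_cup_window_of_criminal` — hence, when the cupped ball `q` lies on or above the cut level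
  (`s ≤ ⟪q, ν⟫`, so that its plugs are `ν`-below it), its cup has between `7` and `9` members and at
  least `2` of them are shallow.  (Cups lean on shallow contacts: the entry point of every layer /
  discharging argument, in the criminal currency.)

WHAT THIS IS NOT: the crux; nothing here bounds the number of cups or pairs them with under-supported
balls (that pairing IS EXACT₀); rung F-C1 not moved.
-/

noncomputable section

namespace Summit.Ventures.Crystal3D.Theorems

open Summit.Ventures.Crystal3D
open Literature.MathematicalPhysics.StatisticalMechanics (fccStacking isHaggSeq_const
  le_dist_of_mem_barlowStacking_ideal contactDeficiency orderedContacts)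
open Literature.Geometry.DiscreteGeometry (card_le_nine_of_unit_normal card_add_card_filter_le_twelve)
open scoped InnerProductSpace
open Finset

/-! ## A gaining film has an over-full ball for every orientation -/

/-- **For every orientation of the contact graph of a gaining film some ball has `plug + indeg ≥ 7`.** -/
theorem exists_seven_le_plug_add_indeg_of_gain {ν : EuclideanSpace ℝ (Fin 3)} {s : ℝ}
    {Q : Finset (EuclideanSpace ℝ (Fin 3))} (hgain : contactDeficiency Q < plugCount ν s Q)
    (o : EuclideanSpace ℝ (Fin 3) → EuclideanSpace ℝ (Fin 3) → ℕ)
    (ho : ∀ q ∈ Q, ∀ q' ∈ Q, dist q q' = 1 → o q q' + o q' q = 1) :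
    ∃ q ∈ Q, 7 ≤ (plugSet ν s q).ncard + ∑ q' ∈ Q.filter (fun q' => dist q q' = 1), o q' q := by
  classical
  by_contra h
  push Not at h
  have hsum : ∑ q ∈ Q, ((plugSet ν s q).ncard +
      ∑ q' ∈ Q.filter (fun q' => dist q q' = 1), o q' q) ≤ 6 * Q.card := by
    calc _ ≤ ∑ q ∈ Q, 6 := Finset.sum_le_sum fun q hq => by have := h q hq; omega
      _ = 6 * Q.card := by rw [Finset.sum_const, smul_eq_mul, mul_comm]
  rw [Finset.sum_add_distrib] at hsum
  have h2 := two_mul_sum_orientation Q o ho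
  have hpc : plugCount ν s Q = ∑ q ∈ Q, (plugSet ν s q).ncard := rfl
  have h3 : (2 : ℝ) * (∑ q ∈ Q, ∑ q' ∈ Q.filter (fun q' => dist q q' = 1), o q' q : ℕ) =
      (orderedContacts Q : ℝ) := by exact_mod_cast h2
  have h4 : ((plugCount ν s Q : ℕ) : ℝ) +
      (∑ q ∈ Q, ∑ q' ∈ Q.filter (fun q' => dist q q' = 1), o q' q : ℕ) ≤ 6 * (Q.card : ℝ) := by
    rw [hpc]; exact_mod_cast hsum
  unfold contactDeficiency at hgain
  linarith

/-- **In a criminal, for every orientation of its contact graph some ball has `plug + indeg ≥ 7`.** -/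
theorem exists_seven_le_plug_add_indeg_of_criminal {ν : EuclideanSpace ℝ (Fin 3)} {s : ℝ}
    {Q : Finset (EuclideanSpace ℝ (Fin 3))} (hQ : IsCriminal ν s Q)
    (o : EuclideanSpace ℝ (Fin 3) → EuclideanSpace ℝ (Fin 3) → ℕ)
    (ho : ∀ q ∈ Q, ∀ q' ∈ Q, dist q q' = 1 → o q q' + o q' q = 1) :
    ∃ q ∈ Q, 7 ≤ (plugSet ν s q).ncard + ∑ q' ∈ Q.filter (fun q' => dist q q' = 1), o q' q := by
  refine exists_seven_le_plug_add_indeg_of_gain ?_ o ho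
  have h1 := hQ.2.2 Q (Finset.Subset.refl Q) hQ.2.1
  simp only [Finset.sdiff_self, Finset.empty_product, Finset.filter_empty, Finset.card_empty,
    Nat.cast_zero, add_zero] at h1
  exact h1

/-! ## The height orientation: cups -/

open scoped Classical in
/-- The `ν`-HEIGHT orientation: the bond `q' — q` points INTO `q` iff `q'` is `ν`-lower than `q`
(ties broken by a fixed well-order of space). -/
theorem heightIndeg_orientation (ν : EuclideanSpace ℝ (Fin 3)) :
    ∀ q q' : EuclideanSpace ℝ (Fin 3), q ≠ q' →
      (if ⟪q', ν⟫_ℝ < ⟪q, ν⟫_ℝ ∨ (⟪q', ν⟫_ℝ = ⟪q, ν⟫_ℝ ∧ WellOrderingRel q' q) then 1 else 0) +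
        (if ⟪q, ν⟫_ℝ < ⟪q', ν⟫_ℝ ∨ (⟪q, ν⟫_ℝ = ⟪q', ν⟫_ℝ ∧ WellOrderingRel q q') then 1 else 0)
          = 1 := by
  intro q q' hne
  rcases lt_trichotomy ⟪q', ν⟫_ℝ ⟪q, ν⟫_ℝ with hlt | heq | hgt
  · rw [if_pos (Or.inl hlt), if_neg]
    rintro (h | ⟨h, -⟩) <;> linarith
  · rcases wellOrderingRel_or hne with h | h
    · rw [if_neg, if_pos (Or.inr ⟨heq.symm, h⟩)]
      rintro (h' | ⟨-, h'⟩)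
      · linarith
      · exact wellOrderingRel_asymm h h'
    · rw [if_pos (Or.inr ⟨heq, h⟩), if_neg]
      rintro (h' | ⟨-, h'⟩)
      · linarith
      · exact wellOrderingRel_asymm h h'
  · rw [if_neg, if_pos (Or.inl hgt)]
    rintro (h | ⟨h, -⟩) <;> linarith

open scoped Classical in
/-- The in-degree of the height orientation counts `ν`-lower partners (lower, or tied and earlier). -/
theorem heightIndeg_eq_card (ν : EuclideanSpace ℝ (Fin 3)) (Q : Finset (EuclideanSpace ℝ (Fin 3)))
    (q : EuclideanSpace ℝ (Fin 3)) :
    ∑ q' ∈ Q.filter (fun q' => dist q q' = 1),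
        (if ⟪q', ν⟫_ℝ < ⟪q, ν⟫_ℝ ∨ (⟪q', ν⟫_ℝ = ⟪q, ν⟫_ℝ ∧ WellOrderingRel q' q) then 1 else 0) =
      (Q.filter fun q' => dist q q' = 1 ∧
        (⟪q', ν⟫_ℝ < ⟪q, ν⟫_ℝ ∨ (⟪q', ν⟫_ℝ = ⟪q, ν⟫_ℝ ∧ WellOrderingRel q' q))).card := by
  rw [Finset.card_eq_sum_ones, Finset.sum_filter, Finset.sum_filter]
  refine Finset.sum_congr rfl fun q' _ => ?_
  by_cases h1 : dist q q' = 1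
  · simp only [h1, true_and, if_true]
  · simp only [h1, false_and, if_false]

open scoped Classical in
/-- **Every criminal has a CUPPED ball**: at least seven among its plugs and its `ν`-lower film
partners (lower, or of equal height and earlier in a fixed well-order). -/
theorem exists_cup_of_criminal {ν : EuclideanSpace ℝ (Fin 3)} {s : ℝ}
    {Q : Finset (EuclideanSpace ℝ (Fin 3))} (hQ : IsCriminal ν s Q) :
    ∃ q ∈ Q, 7 ≤ (plugSet ν s q).ncard +
      (Q.filter fun q' => dist q q' = 1 ∧
        (⟪q', ν⟫_ℝ < ⟪q, ν⟫_ℝ ∨ (⟪q', ν⟫_ℝ = ⟪q, ν⟫_ℝ ∧ WellOrderingRel q' q))).card := by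
  obtain ⟨q, hq, h7⟩ := exists_seven_le_plug_add_indeg_of_criminal hQ
    (fun a b => if ⟪a, ν⟫_ℝ < ⟪b, ν⟫_ℝ ∨ (⟪a, ν⟫_ℝ = ⟪b, ν⟫_ℝ ∧ WellOrderingRel a b) then 1 else 0)
    (fun a _ b _ hab => by
      have hne : a ≠ b := by
        rintro rfl; rw [dist_self] at hab; norm_num at hab
      exact heightIndeg_orientation ν b a hne.symm)
  refine ⟨q, hq, ?_⟩
  rw [heightIndeg_eq_card ν Q q] at h7
  exact h7

/-! ## One-sided kissing: a pocket holds at most nine, and leans on shallow contacts -/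

/-- The partners of a film ball in a closed half-space, translated to the unit sphere: a one-sided
kissing arrangement.  (Internal packaging of the hypotheses of `card_le_nine_of_unit_normal`.) -/
theorem halfspace_partners_code {ν : EuclideanSpace ℝ (Fin 3)} {s : ℝ}
    {Q : Finset (EuclideanSpace ℝ (Fin 3))} (hQ : IsFilmOn ν s Q) (q : EuclideanSpace ℝ (Fin 3))
    (T : Finset (EuclideanSpace ℝ (Fin 3)))
    (hT : ∀ x ∈ T, (x ∈ plugSet ν s q ∨ x ∈ Q) ∧ dist q x = 1) :
    (∀ v ∈ T.image (fun x => x - q), ‖v‖ = 1) ∧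
      (∀ v ∈ T.image (fun x => x - q), ∀ w ∈ T.image (fun x => x - q), v ≠ w → 1 ≤ dist v w) ∧
      (T.image fun x => x - q).card = T.card := by
  classical
  refine ⟨?_, ?_, ?_⟩
  · intro v hv
    obtain ⟨x, hx, rfl⟩ := Finset.mem_image.1 hv
    rw [← dist_eq_norm, dist_comm]; exact (hT x hx).2
  · intro v hv w hw hvw
    obtain ⟨x, hx, rfl⟩ := Finset.mem_image.1 hv
    obtain ⟨y, hy, rfl⟩ := Finset.mem_image.1 hw
    have hxy : x ≠ y := fun h => hvw (by rw [h])
    rw [dist_eq_norm, sub_sub_sub_cancel_right, ← dist_eq_norm]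
    rcases (hT x hx).1 with hx' | hx' <;> rcases (hT y hy).1 with hy' | hy'
    · exact le_dist_of_mem_barlowStacking_ideal isHaggSeq_const one_pos fcc_height_sq hx'.1.1 hy'.1.1 hxy
    · rw [dist_comm]; exact hQ.2 y hy' x hx'.1
    · exact hQ.2 x hx' y hy'.1
    · exact hQ.1 x hx' y hy' hxy
  · exact Finset.card_image_of_injective _ (sub_left_injective)

/-- **A film ball has at most nine partners (plugs or film balls) in any closed half-space through its
centre** (`B(3) = 9`, G. Fejes Tóth / Musin). -/
theorem card_halfspace_partners_le_nine {ν : EuclideanSpace ℝ (Fin 3)} {s : ℝ}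
    {Q : Finset (EuclideanSpace ℝ (Fin 3))} (hQ : IsFilmOn ν s Q) (q : EuclideanSpace ℝ (Fin 3))
    {e : EuclideanSpace ℝ (Fin 3)} (he : ‖e‖ = 1) (T : Finset (EuclideanSpace ℝ (Fin 3)))
    (hT : ∀ x ∈ T, (x ∈ plugSet ν s q ∨ x ∈ Q) ∧ dist q x = 1)
    (hhalf : ∀ x ∈ T, 0 ≤ ⟪e, x - q⟫_ℝ) : T.card ≤ 9 := by
  classical
  obtain ⟨hn, hsep, hcard⟩ := halfspace_partners_code hQ q T hT
  rw [← hcard]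
  refine card_le_nine_of_unit_normal he hn ?_ hsep
  intro v hv
  obtain ⟨x, hx, rfl⟩ := Finset.mem_image.1 hv
  exact hhalf x hx

/-- **Musin's `a + 2b ≤ 12` for the partners of a film ball in a closed half-space**: of `k` such
partners at most `12 − k` are STEEP (`⟪e, x − q⟫ > 1/2`), i.e. `2k ≤ 12 + #shallow`. -/
theorem two_mul_card_halfspace_partners_le {ν : EuclideanSpace ℝ (Fin 3)} {s : ℝ}
    {Q : Finset (EuclideanSpace ℝ (Fin 3))} (hQ : IsFilmOn ν s Q) (q : EuclideanSpace ℝ (Fin 3))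
    {e : EuclideanSpace ℝ (Fin 3)} (he : ‖e‖ = 1) (T : Finset (EuclideanSpace ℝ (Fin 3)))
    (hT : ∀ x ∈ T, (x ∈ plugSet ν s q ∨ x ∈ Q) ∧ dist q x = 1)
    (hhalf : ∀ x ∈ T, 0 ≤ ⟪e, x - q⟫_ℝ) :
    2 * T.card ≤ 12 + (T.filter fun x => ⟪e, x - q⟫_ℝ ≤ 1 / 2).card := by
  classical
  obtain ⟨hn, hsep, hcard⟩ := halfspace_partners_code hQ q T hT
  have h12 := card_add_card_filter_le_twelve he hn (fun v hv => by
    obtain ⟨x, hx, rfl⟩ := Finset.mem_image.1 hv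
    exact hhalf x hx) hsep
  rw [hcard] at h12
  -- the steep partners correspond to the steep unit vectors
  have hsteep : ((T.image fun x => x - q).filter fun v => 1 / 2 < ⟪e, v⟫_ℝ).card =
      (T.filter fun x => 1 / 2 < ⟪e, x - q⟫_ℝ).card := by
    rw [Finset.filter_image]
    exact Finset.card_image_of_injOn (fun x _ y _ h => sub_left_injective h)
  have hsplit := Finset.card_filter_add_card_filter_not (s := T) (fun x => 1 / 2 < ⟪e, x - q⟫_ℝ)
  have hnot : (T.filter fun x => ¬ 1 / 2 < ⟪e, x - q⟫_ℝ) = T.filter fun x => ⟪e, x - q⟫_ℝ ≤ 1 / 2 := by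
    refine Finset.filter_congr fun x _ => ?_
    exact not_lt
  rw [hnot] at hsplit
  omega

/-! ## The cupped ball of a criminal, when it lies on or above the cut -/

open scoped Classical in
/-- **The cup window.**  Every criminal has a cupped ball `q` (`≥ 7` among plugs and `ν`-lower film
partners); if that ball lies on or above the cut level (`s ≤ ⟪q, ν⟫`, so its plugs are `ν`-below it)
the cup has at most `9` members and at least `2` of them are shallow (`⟪q − x, ν⟫ ≤ 1/2`). -/
theorem exists_cup_window_of_criminal {ν : EuclideanSpace ℝ (Fin 3)} (hν : ‖ν‖ = 1) {s : ℝ}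
    {Q : Finset (EuclideanSpace ℝ (Fin 3))} (hQ : IsCriminal ν s Q) :
    ∃ q ∈ Q, 7 ≤ (plugSet ν s q).ncard +
      (Q.filter fun q' => dist q q' = 1 ∧
        (⟪q', ν⟫_ℝ < ⟪q, ν⟫_ℝ ∨ (⟪q', ν⟫_ℝ = ⟪q, ν⟫_ℝ ∧ WellOrderingRel q' q))).card ∧
      (s ≤ ⟪q, ν⟫_ℝ →
        (plugSet ν s q).ncard +
          (Q.filter fun q' => dist q q' = 1 ∧
            (⟪q', ν⟫_ℝ < ⟪q, ν⟫_ℝ ∨ (⟪q', ν⟫_ℝ = ⟪q, ν⟫_ℝ ∧ WellOrderingRel q' q))).card ≤ 9 ∧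
        2 * ((plugSet ν s q).ncard +
          (Q.filter fun q' => dist q q' = 1 ∧
            (⟪q', ν⟫_ℝ < ⟪q, ν⟫_ℝ ∨ (⟪q', ν⟫_ℝ = ⟪q, ν⟫_ℝ ∧ WellOrderingRel q' q))).card) ≤
          12 + ({p ∈ plugSet ν s q | ⟪q - p, ν⟫_ℝ ≤ 1 / 2}.ncard +
            (Q.filter fun q' => dist q q' = 1 ∧
              (⟪q', ν⟫_ℝ < ⟪q, ν⟫_ℝ ∨ (⟪q', ν⟫_ℝ = ⟪q, ν⟫_ℝ ∧ WellOrderingRel q' q)) ∧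
              ⟪q - q', ν⟫_ℝ ≤ 1 / 2).card)) := by
  obtain ⟨q, hq, h7⟩ := exists_cup_of_criminal hQ
  refine ⟨q, hq, h7, fun hs => ?_⟩
  have hfin := plugSet_finite ν s q
  set Lw := Q.filter fun q' => dist q q' = 1 ∧
    (⟪q', ν⟫_ℝ < ⟪q, ν⟫_ℝ ∨ (⟪q', ν⟫_ℝ = ⟪q, ν⟫_ℝ ∧ WellOrderingRel q' q)) with hLw
  set T := hfin.toFinset ∪ Lw with hTdef
  have hdisj : Disjoint hfin.toFinset Lw := by
    rw [Finset.disjoint_left]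
    intro y hy hy'
    rw [Set.Finite.mem_toFinset] at hy
    rw [hLw, Finset.mem_filter] at hy'
    have := hQ.1.2 y hy'.1 y hy.1
    rw [dist_self] at this; linarith
  have hTcard : T.card = (plugSet ν s q).ncard + Lw.card := by
    rw [hTdef, Finset.card_union_of_disjoint hdisj, Set.ncard_eq_toFinset_card _ hfin]
  have hT : ∀ x ∈ T, (x ∈ plugSet ν s q ∨ x ∈ Q) ∧ dist q x = 1 := by
    intro x hx
    rw [hTdef, Finset.mem_union, Set.Finite.mem_toFinset, hLw, Finset.mem_filter] at hx
    rcases hx with hx | hx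
    · exact ⟨Or.inl hx, hx.2⟩
    · exact ⟨Or.inr hx.1, hx.2.1⟩
  -- every member of the cup is `ν`-below `q` (plugs: below the cut; film partners: by definition)
  have he : ‖-ν‖ = 1 := by rw [norm_neg, hν]
  have hhalf : ∀ x ∈ T, 0 ≤ ⟪-ν, x - q⟫_ℝ := by
    intro x hx
    rw [inner_neg_left, real_inner_comm, inner_sub_left]
    rw [hTdef, Finset.mem_union, Set.Finite.mem_toFinset, hLw, Finset.mem_filter] at hx
    rcases hx with hx | hx
    · have := hx.1.2; linarith
    · rcases hx.2.2 with h | ⟨h, -⟩ <;> linarith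
  refine ⟨by rw [← hTcard]; exact card_halfspace_partners_le_nine hQ.1 q he T hT hhalf, ?_⟩
  have h2 := two_mul_card_halfspace_partners_le hQ.1 q he T hT hhalf
  rw [hTcard] at h2
  -- identify the shallow members
  have hshallow : (T.filter fun x => ⟪-ν, x - q⟫_ℝ ≤ 1 / 2).card =
      {p ∈ plugSet ν s q | ⟪q - p, ν⟫_ℝ ≤ 1 / 2}.ncard +
        (Q.filter fun q' => dist q q' = 1 ∧
          (⟪q', ν⟫_ℝ < ⟪q, ν⟫_ℝ ∨ (⟪q', ν⟫_ℝ = ⟪q, ν⟫_ℝ ∧ WellOrderingRel q' q)) ∧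
          ⟪q - q', ν⟫_ℝ ≤ 1 / 2).card := by
    have hrw : ∀ x : EuclideanSpace ℝ (Fin 3), ⟪-ν, x - q⟫_ℝ = ⟪q - x, ν⟫_ℝ := by
      intro x
      rw [inner_neg_left, real_inner_comm, inner_sub_left, inner_sub_left]; ring
    simp_rw [hrw]
    rw [hTdef, Finset.filter_union, Finset.card_union_of_disjoint]
    · congr 1
      · have hfin' : {p ∈ plugSet ν s q | ⟪q - p, ν⟫_ℝ ≤ 1 / 2}.Finite := hfin.subset (fun p hp => hp.1)
        rw [Set.ncard_eq_toFinset_card _ hfin']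
        congr 1
        ext p
        simp only [Finset.mem_filter, Set.Finite.mem_toFinset, Set.mem_setOf_eq]
      · rw [hLw, Finset.filter_filter]
        congr 1
        ext q'
        simp only [Finset.mem_filter, and_assoc]
    · exact Finset.disjoint_filter_filter hdisj
  rw [hshallow] at h2
  exact h2

end Summit.Ventures.Crystal3D.Theorems

end
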